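import Mathlib.LinearAlgebra.Matrix.Kronecker
import Mathlib.LinearAlgebra.Matrix.Trace
import Mathlib.LinearAlgebra.Matrix.Determinant.Basic
import Mathlib.LinearAlgebra.Matrix.Notation
import Literature.NumberTheory.GaloisRepresentations.InducedGaloisRep
import HarnessLib

/-!
# Tensor induction along an index-two subgroup, I: the index-two extension lemma and the
# Kronecker / swap matrix calculus

Helper file 1/3 of stub `stub_tensorInductionPD` (crux `NonParallelVoid.TensorSquareParallel`,
stmt-Langlands-17009, line `merged`): the group-theoretic and matrix part of the TENSOR INDUCTION
`⊗-Ind_{Γ_F}^{Γ_ℚ} ρ` of a framed Galois representation along a quadratic extension (files 2/3: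
`…StubTensorInductionPDConstruction`, the `FramedGaloisRep`; 3/3: `…StubTensorInductionPDForm`, the
conjuncts (T0), (T1), (T2), (T5) of the stub).  Everything here is proved; no named fact.

Let `φ : H →* G` be an injective homomorphism whose image has index two, `τ ∈ G ∖ φ(H)`,
`θ : H →* H` the automorphism with `φ (θ h) = τ φ(h) τ⁻¹` and `t ∈ H` with `φ t = τ²`.  A
homomorphism `D : H →* R` into a semiring extends to `G` as soon as an element `T ∈ R` with
`T D(h) = D(θ h) T` and `T² = D(t)` is given: `ψ(φ h) = D h`, `ψ(φ(h) τ) = D(h) T`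
(`indexTwoExtend`, `indexTwoExtendHom`; written without case distinction as
`ψ g = Ḋ(g) + Ḋ(g τ⁻¹) T` with the extension by zero `Ḋ` of the tree's `InducedGaloisRep`, whence
continuity for an open embedding `φ`, `continuous_indexTwoExtend`).  **Tensor induction** of a matrix
representation `ρ : H →* M_n(A)` along `φ` is the case `D h = ρ h ⊗ₖ ρ (θ h)` (Kronecker product on
`n × n`), `T = (1 ⊗ₖ ρ t) · S` with `S` the swap matrix `x ⊗ y ↦ y ⊗ x` (`swapMatrix`,
`kroneckerPairHom`, `tensorTwist`; the relations are `swapMatrix_mul_kronecker`,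
`tensorTwist_mul_kroneckerPairHom`, `tensorTwist_mul_tensorTwist`).  For `n = 2` the image preserves
the symmetric form `J₄ = J₂ ⊗ₖ J₂`, `J₂ = (0 1; -1 0)`, up to the multiplier `det ⊗ det`
(`kronecker_transpose_mul_J₄_mul`, `swapMatrix_mul_J₄_mul_swapMatrix`).

References: Serre, *Linear representations of finite groups*, §7.2–§8.1 (conjugate representations,
representations of a group with a normal subgroup of index two); Curtis–Reiner, *Methods of
representation theory* I, §13 (tensor induction); F. Calegari, *Even Galois representations and the
Fontaine–Mazur conjecture*, Invent. Math. 185 (2011), §2 (the tensor induction `Γ_F ≤ Γ_ℚ`,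
`[Γ_ℚ : Γ_F] = 2`, landing in `GO₄`).
-/

noncomputable section

set_option linter.dupNamespace false

open Matrix Topology Field
open scoped Kronecker

namespace Summit.Langlands.Langlands.Theorems.TensorSquareParallel

open Literature.NumberTheory.GaloisRepresentations

/-! ### The index-two extension of a homomorphism -/

section IndexTwo

variable {H G R : Type*} [Group H] [Group G] [Semiring R]

/-- **Index-two extension** of `D : H →* R` along `φ : H →* G` with respect to `τ ∈ G` and
`T ∈ R`: `ψ g = Ḋ(g) + Ḋ(g τ⁻¹) T`, i.e. `ψ (φ h) = D h` and `ψ (φ(h) τ) = D(h) T` when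
`τ ∉ φ(H)` (`Ḋ` = extension by zero, `dotExtend`).
Ref: Serre, *Linear representations of finite groups*, §8.1. [folklore] -/
def indexTwoExtend (φ : H →* G) (D : H →* R) (τ : G) (T : R) (g : G) : R :=
  dotExtend φ D g + dotExtend φ D (g * τ⁻¹) * T

variable {φ : H →* G} (hφ : Function.Injective φ) (D : H →* R) {τ : G} (hτ : τ ∉ φ.range)
  (T : R)

include hφ hτ in
/-- `ψ (φ h) = D h`. [folklore] -/
theorem indexTwoExtend_apply_map (h : H) : indexTwoExtend φ D τ T (φ h) = D h := by
  have hn : φ h * τ⁻¹ ∉ φ.range := fun hm => hτ <| by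
    have e : τ = (φ h * τ⁻¹)⁻¹ * φ h := by group
    rw [e]
    exact mul_mem (inv_mem hm) ⟨h, rfl⟩
  rw [indexTwoExtend, dotExtend_apply_map hφ, dotExtend_of_not_mem φ _ hn, zero_mul, add_zero]

include hφ hτ in
/-- `ψ (φ(h) τ) = D(h) T`. [folklore] -/
theorem indexTwoExtend_apply_map_mul (h : H) :
    indexTwoExtend φ D τ T (φ h * τ) = D h * T := by
  have hn : φ h * τ ∉ φ.range := fun hm => hτ <| by
    have e : τ = (φ h)⁻¹ * (φ h * τ) := by group
    rw [e]
    exact mul_mem (inv_mem ⟨h, rfl⟩) hm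
  rw [indexTwoExtend, dotExtend_of_not_mem φ _ hn, zero_add, mul_inv_cancel_right,
    dotExtend_apply_map hφ]

include hφ hτ in
/-- `ψ 1 = 1`. [folklore] -/
theorem indexTwoExtend_one : indexTwoExtend φ D τ T 1 = 1 := by
  have hn : (1 : G) * τ⁻¹ ∉ φ.range := fun hm => hτ <| by
    rw [one_mul] at hm
    exact inv_mem_iff.1 hm
  rw [indexTwoExtend, dotExtend_one hφ, dotExtend_of_not_mem φ _ hn, zero_mul, add_zero]

variable {θ : H →* H} (hθ : ∀ h, φ (θ h) = τ * φ h * τ⁻¹) {t : H} (ht : φ t = τ * τ)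
  (hT : ∀ h, T * D h = D (θ h) * T) (hTT : T * T = D t)

include hφ hθ hT in
/-- `ψ (g φ(h)) = ψ(g) D(h)` (uses `T D(h) = D(θ h) T`). [folklore] -/
theorem indexTwoExtend_mul_map (g : G) (h : H) :
    indexTwoExtend φ D τ T (g * φ h) = indexTwoExtend φ D τ T g * D h := by
  have key : g * φ h * τ⁻¹ = g * τ⁻¹ * φ (θ h) := by rw [hθ]; group
  rw [indexTwoExtend, indexTwoExtend, dotExtend_mul_map hφ, key, dotExtend_mul_map hφ, add_mul,
    mul_assoc _ T (D h), hT h, ← mul_assoc]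

include hφ ht hTT in
/-- `ψ (g τ) = ψ(g) T` (uses `T² = D(t)`, `φ t = τ²`). [folklore] -/
theorem indexTwoExtend_mul_tau (g : G) :
    indexTwoExtend φ D τ T (g * τ) = indexTwoExtend φ D τ T g * T := by
  have key : g * τ⁻¹ * φ t = g * τ := by rw [ht]; group
  rw [indexTwoExtend, indexTwoExtend, mul_inv_cancel_right, add_mul, mul_assoc, hTT,
    ← dotExtend_mul_map hφ, key, add_comm]

include hφ hτ hθ ht hT hTT in
/-- **`ψ` is multiplicative** when `φ(H)` has index two (`g ∉ φ(H) ⟹ g τ⁻¹ ∈ φ(H)`).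
Ref: Serre, *Linear representations of finite groups*, §8.1. [folklore] -/
theorem indexTwoExtend_mul (h2 : ∀ g, g ∉ φ.range → g * τ⁻¹ ∈ φ.range) (g g' : G) :
    indexTwoExtend φ D τ T (g * g') = indexTwoExtend φ D τ T g * indexTwoExtend φ D τ T g' := by
  by_cases hg' : g' ∈ φ.range
  · obtain ⟨h, rfl⟩ := hg'
    rw [indexTwoExtend_mul_map hφ D T hθ hT, indexTwoExtend_apply_map hφ D hτ T]
  · obtain ⟨h, hh⟩ := h2 g' hg'
    have hg'eq : g' = φ h * τ := by rw [hh]; group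
    rw [hg'eq, ← mul_assoc, indexTwoExtend_mul_tau hφ D T ht hTT,
      indexTwoExtend_mul_map hφ D T hθ hT, indexTwoExtend_apply_map_mul hφ D hτ T, mul_assoc]

/-- **The index-two extension as a monoid homomorphism `G →* R`.**
Ref: Serre, *Linear representations of finite groups*, §8.1. [folklore] -/
def indexTwoExtendHom (h2 : ∀ g, g ∉ φ.range → g * τ⁻¹ ∈ φ.range) : G →* R where
  toFun := indexTwoExtend φ D τ T
  map_one' := indexTwoExtend_one hφ D hτ T
  map_mul' := indexTwoExtend_mul hφ D hτ T hθ ht hT hTT h2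

/-- Unfolding lemma for `indexTwoExtendHom`. [folklore] -/
@[simp] theorem indexTwoExtendHom_apply (h2 : ∀ g, g ∉ φ.range → g * τ⁻¹ ∈ φ.range) (g : G) :
    indexTwoExtendHom hφ D hτ T hθ ht hT hTT h2 g = indexTwoExtend φ D τ T g := rfl

end IndexTwo

section Continuity

variable {H G R : Type*} [Group H] [TopologicalSpace H] [Group G] [TopologicalSpace G]
  [IsTopologicalGroup G] [Semiring R] [TopologicalSpace R] [IsTopologicalSemiring R]

/-- **`ψ` is continuous** for an open embedding `φ` and a continuous `D` (`Ḋ` is continuous,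
`continuous_dotExtend`). [folklore] -/
theorem continuous_indexTwoExtend {φ : H →* G} (hφ : IsOpenEmbedding φ) {D : H →* R}
    (hD : Continuous D) (τ : G) (T : R) : Continuous (indexTwoExtend φ D τ T) :=
  (continuous_dotExtend hφ hD).add
    (((continuous_dotExtend hφ hD).comp (continuous_id.mul continuous_const)).mul continuous_const)

end Continuity

/-! ### The swap matrix and Kronecker products -/

section Swap

variable (n A : Type*) [Fintype n] [DecidableEq n] [CommRing A]

/-- **The swap matrix** `S` on `n × n`: the permutation matrix of `x ⊗ y ↦ y ⊗ x`
(`S *ᵥ (x ⊗ y) = y ⊗ x`; entry `((i,k),(j,l))` is `1` iff `(i,k) = (l,j)`). [folklore] -/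
def swapMatrix : Matrix (n × n) (n × n) A :=
  (1 : Matrix (n × n) (n × n) A).submatrix (Equiv.refl _) (Equiv.prodComm n n)

variable {n A}

/-- `S M` permutes the rows by the swap. [folklore] -/
theorem swapMatrix_mul (M : Matrix (n × n) (n × n) A) :
    swapMatrix n A * M = M.submatrix Prod.swap id := by
  rw [swapMatrix, one_submatrix_mul]
  rfl

/-- `M S` permutes the columns by the swap. [folklore] -/
theorem mul_swapMatrix (M : Matrix (n × n) (n × n) A) :
    M * swapMatrix n A = M.submatrix id Prod.swap := by
  rw [swapMatrix, mul_submatrix_one]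
  rfl

/-- `S² = 1`. [folklore] -/
theorem swapMatrix_mul_swapMatrix : swapMatrix n A * swapMatrix n A = 1 := by
  rw [swapMatrix_mul, swapMatrix, submatrix_submatrix]
  exact submatrix_one_equiv (Equiv.prodComm n n)

omit [Fintype n] in
/-- `Sᵀ = S`. [folklore] -/
theorem transpose_swapMatrix : (swapMatrix n A)ᵀ = swapMatrix n A := by
  ext ⟨i, k⟩ ⟨j, l⟩
  simp only [swapMatrix, transpose_apply, submatrix_apply, Equiv.refl_apply, Equiv.prodComm_apply,
    Prod.swap_prod_mk, Matrix.one_apply, Prod.mk.injEq]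
  by_cases h₁ : i = l <;> by_cases h₂ : k = j <;> simp [h₁, h₂, eq_comm]

/-- **`S (M ⊗ N) = (N ⊗ M) S`**: conjugation by the swap exchanges the Kronecker factors. [folklore] -/
theorem swapMatrix_mul_kronecker (M N : Matrix n n A) :
    swapMatrix n A * M ⊗ₖ N = N ⊗ₖ M * swapMatrix n A := by
  rw [swapMatrix_mul, mul_swapMatrix]
  ext ⟨i, k⟩ ⟨j, l⟩
  simp [mul_comm]

/-- **`tr ((M ⊗ N) S) = tr (M N)`.** [folklore] -/
theorem trace_kronecker_mul_swapMatrix (M N : Matrix n n A) :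
    (M ⊗ₖ N * swapMatrix n A).trace = (M * N).trace := by
  rw [mul_swapMatrix]
  simp [Matrix.trace, Matrix.mul_apply, Fintype.sum_prod_type]

end Swap

/-! ### The Kronecker pair of two homomorphisms and the tensor twist `T` -/

section KroneckerHom

variable {H : Type*} [Group H] {n A : Type*} [Fintype n] [DecidableEq n] [CommRing A]

/-- `h ↦ D₁ h ⊗ₖ D₂ h` as a monoid homomorphism (`(A B) ⊗ (A' B') = (A ⊗ A')(B ⊗ B')`). [folklore] -/
def kroneckerPairHom (D₁ D₂ : H →* Matrix n n A) : H →* Matrix (n × n) (n × n) A where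
  toFun h := D₁ h ⊗ₖ D₂ h
  map_one' := by rw [map_one, map_one, one_kronecker_one]
  map_mul' a b := by rw [map_mul, map_mul, mul_kronecker_mul]

/-- Unfolding lemma for `kroneckerPairHom`. [folklore] -/
@[simp] theorem kroneckerPairHom_apply (D₁ D₂ : H →* Matrix n n A) (h : H) :
    kroneckerPairHom D₁ D₂ h = D₁ h ⊗ₖ D₂ h := rfl

variable (ρ : H →* Matrix n n A) (θ : H →* H) (t : H)

/-- **The tensor twist** `T = (1 ⊗ ρ t) S`: the matrix of `x ⊗ y ↦ y ⊗ ρ(t) x`, the value at `τ`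
of the tensor induction (`φ t = τ²`).
Ref: Curtis–Reiner, *Methods of representation theory* I, §13. [folklore] -/
def tensorTwist : Matrix (n × n) (n × n) A :=
  (1 : Matrix n n A) ⊗ₖ ρ t * swapMatrix n A

/-- **`T (ρ h ⊗ ρ θh) = (ρ θh ⊗ ρ θ²h) T`** provided `t h = θ(θ h) t` in `H`. [folklore] -/
theorem tensorTwist_mul_kroneckerPairHom (hθθ : ∀ h, t * h = θ (θ h) * t) (h : H) :
    tensorTwist ρ t * kroneckerPairHom ρ (ρ.comp θ) h =
      kroneckerPairHom ρ (ρ.comp θ) (θ h) * tensorTwist ρ t := by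
  simp only [tensorTwist, kroneckerPairHom_apply, MonoidHom.coe_comp, Function.comp_apply]
  rw [mul_assoc, swapMatrix_mul_kronecker, ← mul_assoc, ← mul_kronecker_mul, one_mul, ← mul_assoc,
    ← mul_kronecker_mul, mul_one, ← map_mul, ← map_mul, hθθ]

/-- **`T² = ρ t ⊗ ρ (θ t)`** provided `θ t = t`. [folklore] -/
theorem tensorTwist_mul_tensorTwist (hθt : θ t = t) :
    tensorTwist ρ t * tensorTwist ρ t = kroneckerPairHom ρ (ρ.comp θ) t := by
  simp only [tensorTwist, kroneckerPairHom_apply, MonoidHom.coe_comp, Function.comp_apply, hθt]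
  rw [mul_assoc, ← mul_assoc (swapMatrix n A), swapMatrix_mul_kronecker, mul_assoc,
    swapMatrix_mul_swapMatrix, mul_one, ← mul_kronecker_mul, one_mul, mul_one]

/-- `(M ⊗ N) T = (M ⊗ N ρ(t)) S`: the value of the tensor induction on the nontrivial coset is a
Kronecker product followed by the swap. [folklore] -/
theorem kronecker_mul_tensorTwist (M N : Matrix n n A) :
    M ⊗ₖ N * tensorTwist ρ t = M ⊗ₖ (N * ρ t) * swapMatrix n A := by
  rw [tensorTwist, ← mul_assoc, ← mul_kronecker_mul, mul_one]

end KroneckerHom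

/-! ### The symmetric form `J₄ = J₂ ⊗ J₂` preserved by `GL₂ ⊗ GL₂` and by the swap -/

section Form

variable {A : Type*} [CommRing A]

/-- `J₂ = (0 1; -1 0)`, the standard alternating form on `A²` (`Mᵀ J₂ M = det M · J₂`). [folklore] -/
def J₂ : Matrix (Fin 2) (Fin 2) A := !![0, 1; -1, 0]

/-- **`Mᵀ J₂ M = det(M) J₂`** for every `2 × 2` matrix. [folklore] -/
theorem transpose_mul_J₂_mul (M : Matrix (Fin 2) (Fin 2) A) : Mᵀ * J₂ * M = M.det • J₂ := by
  ext i j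
  rw [Matrix.det_fin_two]
  fin_cases i <;> fin_cases j <;>
    simp [J₂, Matrix.mul_apply, Fin.sum_univ_two] <;> ring

/-- `J₂ᵀ = -J₂`. [folklore] -/
theorem transpose_J₂ : (J₂ : Matrix (Fin 2) (Fin 2) A)ᵀ = -J₂ := by
  ext i j
  fin_cases i <;> fin_cases j <;> simp [J₂]

/-- `det J₂ = 1`. [folklore] -/
theorem det_J₂ : (J₂ : Matrix (Fin 2) (Fin 2) A).det = 1 := by
  rw [Matrix.det_fin_two]
  simp [J₂]

/-- `J₄ = J₂ ⊗ J₂`, a symmetric form on `A² ⊗ A²` (the product of two alternating forms). [folklore] -/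
def J₄ : Matrix (Fin 2 × Fin 2) (Fin 2 × Fin 2) A := J₂ ⊗ₖ J₂

/-- `J₄` is symmetric. [folklore] -/
theorem transpose_J₄ : (J₄ : Matrix _ _ A)ᵀ = J₄ := by
  rw [J₄, ← kroneckerMap_transpose, transpose_J₂]
  ext ⟨i, k⟩ ⟨j, l⟩
  simp

/-- `det J₄ = 1`. [folklore] -/
theorem det_J₄ : (J₄ : Matrix _ _ A).det = 1 := by
  rw [J₄, det_kronecker, det_J₂]
  simp

/-- **`(M ⊗ N)ᵀ J₄ (M ⊗ N) = det(M) det(N) J₄`**: `GL₂ ⊗ GL₂` preserves `J₄` up to the multiplier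
`det ⊗ det`. [folklore] -/
theorem kronecker_transpose_mul_J₄_mul (M N : Matrix (Fin 2) (Fin 2) A) :
    (M ⊗ₖ N)ᵀ * J₄ * (M ⊗ₖ N) = (M.det * N.det) • J₄ := by
  rw [J₄, ← kroneckerMap_transpose, ← mul_kronecker_mul, ← mul_kronecker_mul,
    transpose_mul_J₂_mul, transpose_mul_J₂_mul, smul_kronecker, kronecker_smul, smul_smul]

/-- **`S J₄ S = J₄`**: the swap preserves `J₄`. [folklore] -/
theorem swapMatrix_mul_J₄_mul_swapMatrix :
    swapMatrix (Fin 2) A * J₄ * swapMatrix (Fin 2) A = J₄ := by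
  rw [J₄, swapMatrix_mul_kronecker, mul_assoc, swapMatrix_mul_swapMatrix, mul_one]

/-- `Sᵀ J₄ S = 1 • J₄`. [folklore] -/
theorem swapMatrix_transpose_mul_J₄_mul :
    (swapMatrix (Fin 2) A)ᵀ * J₄ * swapMatrix (Fin 2) A = (1 : A) • J₄ := by
  rw [transpose_swapMatrix, swapMatrix_mul_J₄_mul_swapMatrix, one_smul]

/-- The similitudes of `J₄` are closed under products, with multiplicative multiplier. [folklore] -/
theorem transpose_mul_J₄_mul_of_mul {P T : Matrix (Fin 2 × Fin 2) (Fin 2 × Fin 2) A} {c d : A}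
    (hP : Pᵀ * J₄ * P = c • J₄) (hT : Tᵀ * J₄ * T = d • J₄) :
    (P * T)ᵀ * J₄ * (P * T) = (c * d) • J₄ :=
  calc (P * T)ᵀ * J₄ * (P * T) = Tᵀ * (Pᵀ * J₄ * P) * T := by
        rw [transpose_mul]; simp only [Matrix.mul_assoc]
    _ = (c * d) • J₄ := by rw [hP, Matrix.mul_smul, Matrix.smul_mul, hT, smul_smul]

/-- **`Tᵀ J₄ T = det ρ(t) · J₄`** for the tensor twist `T = (1 ⊗ ρ t) S`. [folklore] -/
theorem tensorTwist_transpose_mul_J₄_mul {H : Type*} [Group H] (ρ : H →* Matrix (Fin 2) (Fin 2) A)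
    (t : H) : (tensorTwist ρ t)ᵀ * J₄ * tensorTwist ρ t = (ρ t).det • J₄ := by
  rw [tensorTwist, transpose_mul_J₄_mul_of_mul (kronecker_transpose_mul_J₄_mul 1 (ρ t))
    swapMatrix_transpose_mul_J₄_mul, det_one, one_mul, mul_one]

end Form

/-! ### Two trace lemmas -/

section Trace

/-- `tr (reindex e e M) = tr M`. [folklore] -/
theorem trace_reindex {o o' R : Type*} [Fintype o] [Fintype o'] [AddCommMonoid R] (e : o ≃ o')
    (M : Matrix o o R) : (Matrix.reindex e e M).trace = M.trace :=
  e.symm.sum_comp (fun i => M i i)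

/-- `tr ρ(a b a⁻¹) = tr ρ(b)` for a framed representation. [folklore] -/
theorem trace_conj_eq_trace {G A : Type*} [Group G] [TopologicalSpace G] [CommRing A]
    [TopologicalSpace A] {n : ℕ} (ρ : FramedRep G A n) (a b : G) :
    FramedRep.trace ρ (a * b * a⁻¹) = FramedRep.trace ρ b := by
  unfold FramedRep.trace
  rw [map_mul, map_mul, map_inv, Units.val_mul, Units.val_mul, Matrix.trace_mul_cycle, Units.inv_mul,
    one_mul]

end Trace

/-! ### The registered sub-goal: existence of the index-two extension -/

section Stub

/-- **Registered sub-goal `stub_tensorInductionPD_indexTwoExtension` of stub `stub_tensorInductionPD`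
(crux `TensorSquareParallel`)**: a homomorphism `D : H →* R` extends along an injective `φ : H →* G`
whose image has two cosets `φ(H)`, `φ(H) τ`, as soon as `T ∈ R` with `T D(h) = D(θ h) T` and
`T² = D(t)` is given (`θ` the conjugation by `τ` pulled back to `H`, `φ t = τ²`); the extension
takes `τ` to `T` (`indexTwoExtendHom`).  Ref: Serre, *Linear representations of finite groups*,
§8.1; Curtis–Reiner, *Methods of representation theory* I, §13. [folklore] -/
theorem stub_tensorInductionPD_indexTwoExtension : ∀ (H G R : Type) [Group H] [Group G] [Semiring R] (φ : H →* G), Function.Injective φ → ∀ (τ : G), τ ∉ φ.range → (∀ g : G, g ∉ φ.range → g * τ⁻¹ ∈ φ.range) → ∀ (D : H →* R) (θ : H →* H), (∀ h : H, φ (θ h) = τ * φ h * τ⁻¹) → ∀ (t : H), φ t = τ * τ → ∀ (T : R), (∀ h : H, T * D h = D (θ h) * T) → T * T = D t → ∃ ψ : G →* R, (∀ h : H, ψ (φ h) = D h) ∧ ψ τ = T := by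
  intro H G R _ _ _ φ hφ τ hτ h2 D θ hθ t ht T hT hTT
  refine ⟨indexTwoExtendHom hφ D hτ T hθ ht hT hTT h2, fun h => indexTwoExtend_apply_map hφ D hτ T h, ?_⟩
  have key := indexTwoExtend_apply_map_mul hφ D hτ T 1
  rw [map_one, one_mul, map_one, one_mul] at key
  exact key

end Stub

end Summit.Langlands.Langlands.Theorems.TensorSquareParallel

end
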